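import Literature.Analysis.FunctionSpaces.SmoothSobolevFourier
import Literature.Analysis.FluidPDE.SmoothL2FieldCalculus
import Mathlib.MeasureTheory.Constructions.HaarToSphere
import Mathlib.MeasureTheory.Measure.Lebesgue.VolumeOfBalls
import Mathlib.Analysis.SpecialFunctions.ImproperIntegrals

/-!
# Agmon's inequality on a three-dimensional space with an EXPLICIT constant, I: the Fourier side

Cell `ns-blowup`, seat `ns-palasek-19179-p2` (g6; holder-of-record lineage of crux
stmt-NavierStokesRegularity-19179 `EpisodeBase`, route `PalasekTowerBreakdown`; `--supports
stmt-NavierStokesRegularity-19179`). Support for the stub `stub_strain_door : StrainDoor` of the strategist line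
`Cruxes/EpisodeBase/Lines/straindoor.lean` (cstrat-19179, v2), whose numerals (`κ²/(100(1+T)^{3/4})`, `4Be^{Λ/2} ≤ δκ^{3/2}`)
presuppose a NUMERICAL Agmon constant on `ℝ³` — the tree's `Literature.Analysis.FluidPDE.agmonConst`
(`NSStrongSpeedBound`) is a `Classical.choose`-type constant with no value. This series (I: this file; II:
`…AgmonSplit`; III: `…AgmonExplicit`) proves, for every smooth `L²` field `v` (all derivatives in `L²`) on a real
inner product space `E` of dimension three and every `x`,

  `‖v(x)‖ ≤ (√2/π) · (∑ᵢ ‖∂ᵢv‖₂²)^{1/4} · (∑ᵢⱼ ‖∂ᵢ∂ⱼv‖₂²)^{1/4}`,   `√2/π = 0.4501…`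

(partial derivatives along the standard orthonormal basis; scalar, complex and vector-valued versions), by the
Fourier split `|v(x)| ≤ ∫_{‖ξ‖<R} |a| + ∫_{‖ξ‖≥R} |a|`, `a = 𝓕⁻¹v`, Cauchy–Schwarz with the weights `(2π‖ξ‖)^{∓1}`,
`(2π‖ξ‖)^{∓2}`, the radial integrals `∫_{‖ξ‖<R} ‖ξ‖⁻² = 4πR`, `∫_{‖ξ‖≥R} ‖ξ‖⁻⁴ = 4π/R`, Plancherel with the
symbol rule, and the optimal radius `R = ‖D²v‖/(2π‖Dv‖)` (the sharp constant is `1/√(2π) = 0.3989…`; the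
split costs the factor `(a² + b²)^{1/2} ≤ a + b`). LABEL: E–C analysis (KERNEL: theorems only; no definition, no
named fact, no `sorry`; register-free). WHAT THIS IS NOT: not Navier–Stokes evidence — a Sobolev inequality;
no flow, run, design or blow-up is exhibited or asserted.

THIS FILE (I): the two radial integrals in dimension three (`volume_real_ball_zero_one`,
`lintegral_ball_norm_sq_inv`, `lintegral_compl_ball_norm_pow_four_inv`, via Mathlib's polar-coordinates formula
`integral_fun_norm_addHaar` and `InnerProductSpace.volume_ball_of_dim_odd`), and the Fourier side for
`f : E → ℂ` smooth with all derivatives in `L²`, `a = 𝓕⁻¹f` the tree's `L²` inverse transform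
(`Literature/Analysis/FunctionSpaces/SmoothSobolevFourier`): `‖f(x)‖ₑ ≤ ∫⁻ ‖a‖ₑ` (`enorm_le_lintegral_enorm_fourierInv`,
inversion `f = 𝓕a` and `a ∈ L¹`), and the weighted Plancherel identities `∫ (2π‖ξ‖)² ‖a‖² = ∑ᵢ ‖∂ᵢf‖₂²`
(`lintegral_weight_two_fourierInv`) and `∫ (2π‖ξ‖)⁴ ‖a‖² = ∑ᵢⱼ ‖∂ᵢ∂ⱼf‖₂²` (`lintegral_weight_four_fourierInv`:
the order-one symbol rule `⟪ξ, bⱼ⟫ a = (−2πi)⁻¹ 𝓕⁻¹(∂ⱼf)` a.e., then Plancherel for `∂ⱼf` in the direction `bᵢ`).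

References: S. Agmon, *Lectures on Elliptic Boundary Value Problems*, Van Nostrand 1965, §13 (the inequality);
J. C. Robinson, J. L. Rodrigo, W. Sadowski, *The three-dimensional Navier–Stokes equations*, CUP 2016,
Thm. 1.20 [cite: RobinsonRodrigoSadowski2016, Thm. 1.20]; E. M. Stein, G. Weiss, *Introduction to Fourier
Analysis on Euclidean Spaces*, Princeton 1971, Ch. I Thm. 1.8, Thm. 2.3 [cite: SteinWeiss1971, Ch. I Thm. 2.3].
-/

noncomputable section

set_option linter.dupNamespace false

open MeasureTheory Filter Function Set Metric
open Literature.Analysis.FunctionSpaces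
open scoped ENNReal NNReal RealInnerProductSpace Topology FourierTransform ContDiff

namespace Summit.NavierStokesRegularity.NavierStokesRegularity.Theorems.AgmonExplicit

variable {E : Type*} [NormedAddCommGroup E] [InnerProductSpace ℝ E] [FiniteDimensional ℝ E]
  [MeasurableSpace E] [BorelSpace E]

/-! ## §1 Two radial integrals in dimension three -/

section Radial

/-- The unit ball of a three-dimensional real inner product space has volume `4π/3`.
[cite: SteinWeiss1971, Ch. I Thm. 2.3] -/
theorem volume_real_ball_zero_one (h3 : Module.finrank ℝ E = 3) :
    (volume : Measure E).real (ball (0 : E) 1) = 4 / 3 * Real.pi := by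
  have hk : Module.finrank ℝ E = 2 * 1 + 1 := by rw [h3]
  rw [Measure.real, InnerProductSpace.volume_ball_of_dim_odd hk, h3]
  have h3f : Nat.doubleFactorial 3 = 3 := by decide
  rw [h3f, ENNReal.ofReal_one, one_pow, one_mul, ENNReal.toReal_ofReal (by positivity)]
  push_cast
  ring

/-- `∫_{‖ξ‖ < R} ‖ξ‖⁻² dξ = 4πR` in dimension three (polar coordinates). [cite: SteinWeiss1971, Ch. I Thm. 2.3] -/
theorem lintegral_ball_norm_sq_inv (h3 : Module.finrank ℝ E = 3) {R : ℝ} (hR : 0 < R) :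
    ∫⁻ ξ in ball (0 : E) R, ENNReal.ofReal ((‖ξ‖ ^ 2)⁻¹) = ENNReal.ofReal (4 * Real.pi * R) := by
  haveI : Nontrivial E := Module.nontrivial_of_finrank_pos (R := ℝ) (by rw [h3]; norm_num)
  -- the radial profile
  set φ : ℝ → ℝ := fun r => if r < R then (r ^ 2)⁻¹ else 0 with hφ
  have hind : ∀ ξ : E, (ball (0 : E) R).indicator (fun ξ => ENNReal.ofReal ((‖ξ‖ ^ 2)⁻¹)) ξ =
      ENNReal.ofReal (φ ‖ξ‖) := by
    intro ξ
    by_cases h : ξ ∈ ball (0 : E) R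
    · rw [indicator_of_mem h, hφ]; simp only [mem_ball_zero_iff.1 h, if_true]
    · rw [indicator_of_notMem h, hφ]
      simp only [show ¬ ‖ξ‖ < R from fun h' => h (mem_ball_zero_iff.2 h'), if_false, ENNReal.ofReal_zero]
  have hφ0 : ∀ r, 0 ≤ φ r := fun r => by
    simp only [hφ]; split_ifs <;> positivity
  -- the one-dimensional integrand `r² φ(r) = 𝟙_{(0,R)}` on `(0, ∞)`
  have hrad : ∀ y ∈ Ioi (0 : ℝ), y ^ (Module.finrank ℝ E - 1) • φ y = (Iio R).indicator (fun _ => (1 : ℝ)) y := by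
    intro y hy
    rw [h3]
    simp only [hφ, smul_eq_mul, show 3 - 1 = 2 by norm_num]
    by_cases hyR : y < R
    · rw [if_pos hyR, indicator_of_mem (mem_Iio.2 hyR), mul_inv_cancel₀ (pow_ne_zero 2 (ne_of_gt hy))]
    · rw [if_neg hyR, indicator_of_notMem (fun h => hyR (mem_Iio.1 h)), mul_zero]
  have hint1 : IntegrableOn (fun y : ℝ => y ^ (Module.finrank ℝ E - 1) • φ y) (Ioi 0) := by
    refine (IntegrableOn.congr_fun ?_ (fun y hy => (hrad y hy).symm) measurableSet_Ioi)
    rw [IntegrableOn, integrable_indicator_iff measurableSet_Iio]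
    exact integrableOn_const (by
      rw [Measure.restrict_apply measurableSet_Iio, show Iio R ∩ Ioi 0 = Ioo 0 R by ext y; simp [and_comm]]
      simp [Real.volume_Ioo])
  have hint : Integrable (fun ξ : E => φ ‖ξ‖) := (integrable_fun_norm_addHaar volume).2 hint1
  rw [← lintegral_indicator measurableSet_ball]
  simp_rw [hind]
  rw [← ofReal_integral_eq_lintegral_ofReal hint (Eventually.of_forall fun ξ => hφ0 _),
    integral_fun_norm_addHaar volume φ, volume_real_ball_zero_one h3,
    setIntegral_congr_fun measurableSet_Ioi hrad, setIntegral_indicator measurableSet_Iio,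
    setIntegral_const, h3]
  have hIoo : Ioi 0 ∩ Iio R = Ioo 0 R := by ext y; simp
  rw [hIoo, Real.volume_real_Ioo, max_eq_left (by linarith)]
  congr 1
  simp only [nsmul_eq_mul, smul_eq_mul, Nat.cast_ofNat]
  ring

/-- `∫_{‖ξ‖ ≥ R} ‖ξ‖⁻⁴ dξ = 4π/R` in dimension three (polar coordinates). [cite: SteinWeiss1971, Ch. I Thm. 2.3] -/
theorem lintegral_compl_ball_norm_pow_four_inv (h3 : Module.finrank ℝ E = 3) {R : ℝ} (hR : 0 < R) :
    ∫⁻ ξ in (ball (0 : E) R)ᶜ, ENNReal.ofReal ((‖ξ‖ ^ 4)⁻¹) = ENNReal.ofReal (4 * Real.pi / R) := by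
  haveI : Nontrivial E := Module.nontrivial_of_finrank_pos (R := ℝ) (by rw [h3]; norm_num)
  set φ : ℝ → ℝ := fun r => if R ≤ r then (r ^ 4)⁻¹ else 0 with hφ
  have hind : ∀ ξ : E, (ball (0 : E) R)ᶜ.indicator (fun ξ => ENNReal.ofReal ((‖ξ‖ ^ 4)⁻¹)) ξ =
      ENNReal.ofReal (φ ‖ξ‖) := by
    intro ξ
    by_cases h : ξ ∈ (ball (0 : E) R)ᶜ
    · rw [indicator_of_mem h, hφ]
      have : R ≤ ‖ξ‖ := by simpa [mem_ball_zero_iff] using h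
      simp only [this, if_true]
    · rw [indicator_of_notMem h, hφ]
      have : ¬ R ≤ ‖ξ‖ := by simpa [mem_ball_zero_iff] using h
      simp only [this, if_false, ENNReal.ofReal_zero]
  have hφ0 : ∀ r, 0 ≤ φ r := fun r => by
    simp only [hφ]; split_ifs <;> positivity
  -- the one-dimensional integrand `r² φ(r) = 𝟙_{[R,∞)} r⁻²` on `(0, ∞)`
  have hrad : ∀ y ∈ Ioi (0 : ℝ), y ^ (Module.finrank ℝ E - 1) • φ y =
      (Ici R).indicator (fun r => r ^ (-2 : ℝ)) y := by
    intro y hy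
    rw [h3]
    simp only [hφ, smul_eq_mul, show 3 - 1 = 2 by norm_num]
    by_cases hyR : R ≤ y
    · rw [if_pos hyR, indicator_of_mem (mem_Ici.2 hyR)]
      have hy0 : (0 : ℝ) < y := hy
      rw [Real.rpow_neg hy0.le, show (2 : ℝ) = ((2 : ℕ) : ℝ) by norm_num, Real.rpow_natCast]
      field_simp
    · rw [if_neg hyR, indicator_of_notMem (fun h => hyR (mem_Ici.1 h)), mul_zero]
  have hIci : IntegrableOn (fun r : ℝ => r ^ (-2 : ℝ)) (Ici R) := by
    rw [integrableOn_Ici_iff_integrableOn_Ioi]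
    exact integrableOn_Ioi_rpow_of_lt (by norm_num) hR
  have hint1 : IntegrableOn (fun y : ℝ => y ^ (Module.finrank ℝ E - 1) • φ y) (Ioi 0) := by
    refine (IntegrableOn.congr_fun ?_ (fun y hy => (hrad y hy).symm) measurableSet_Ioi)
    rw [IntegrableOn, integrable_indicator_iff measurableSet_Ici]
    exact hIci.mono_measure Measure.restrict_le_self
  have hint : Integrable (fun ξ : E => φ ‖ξ‖) := (integrable_fun_norm_addHaar volume).2 hint1
  rw [← lintegral_indicator measurableSet_ball.compl]
  simp_rw [hind]
  rw [← ofReal_integral_eq_lintegral_ofReal hint (Eventually.of_forall fun ξ => hφ0 _),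
    integral_fun_norm_addHaar volume φ, volume_real_ball_zero_one h3,
    setIntegral_congr_fun measurableSet_Ioi hrad, setIntegral_indicator measurableSet_Ici, h3]
  have hII : Ioi 0 ∩ Ici R = Ici R := by
    ext y; simp only [mem_inter_iff, mem_Ici, mem_Ioi, and_iff_right_iff_imp]; intro h; linarith
  rw [hII, integral_Ici_eq_integral_Ioi, integral_Ioi_rpow_of_lt (by norm_num) hR]
  congr 1
  simp only [nsmul_eq_mul, smul_eq_mul, Nat.cast_ofNat]
  have hR0 : R ≠ 0 := hR.ne'
  rw [show (-2 : ℝ) + 1 = -1 by norm_num, Real.rpow_neg_one]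
  field_simp

end Radial

/-! ## §2 The Fourier side: `f = 𝓕a`, `a = 𝓕⁻¹f ∈ L¹ ∩ L²`, and the weighted Plancherel identities -/

section Fourier

variable {f : E → ℂ}

/-- **`‖f(x)‖ ≤ ∫ ‖a‖`** with `a = 𝓕⁻¹ f` (Fourier inversion `f = 𝓕 a` for `f` smooth with all derivatives in
`L²`, and `‖𝓕 a(x)‖ ≤ ‖a‖_{L¹}`). [cite: SteinWeiss1971, Ch. I Thm. 2.3] -/
theorem enorm_le_lintegral_enorm_fourierInv (hf : ContDiff ℝ ∞ f)
    (hn : ∀ n : ℕ, ∫⁻ x, ‖iteratedFDeriv ℝ n f x‖ₑ ^ 2 < ⊤) (x : E) :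
    ‖f x‖ₑ ≤ ∫⁻ ξ, ‖((𝓕⁻ ((memLp_two_of_smooth hf (hn 0)).toLp f) : Lp ℂ 2 (volume : Measure E)) :
      E → ℂ) ξ‖ₑ := by
  set A : E → ℂ := ((𝓕⁻ ((memLp_two_of_smooth hf (hn 0)).toLp f) : Lp ℂ 2 (volume : Measure E)) :
    E → ℂ) with hA
  have hA1 : Integrable A := integrable_fourierInv_of_smooth hf hn
  have hinv : 𝓕 A = f := fourierIntegral_fourierInv_eq_of_smooth hf hn
  have h1 : ‖f x‖ ≤ ∫ ξ, ‖A ξ‖ := by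
    rw [← hinv, Real.fourier_eq]
    refine (norm_integral_le_integral_norm _).trans (le_of_eq ?_)
    refine integral_congr_ae (Eventually.of_forall fun ξ => ?_)
    simp only [Circle.norm_smul]
  rw [← ofReal_norm, ← ofReal_integral_norm_eq_lintegral_enorm hA1]
  exact ENNReal.ofReal_le_ofReal h1

omit [FiniteDimensional ℝ E] [MeasurableSpace E] [BorelSpace E] in
/-- Pointwise: `‖(c : ℂ) z‖ₑ² = ofReal (c²) ‖z‖ₑ²` for a real scalar `c`. [cite: SteinWeiss1971, Ch. I Thm. 2.3] -/
theorem enorm_ofReal_mul_sq (c : ℝ) (z : ℂ) :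
    ‖(c : ℂ) * z‖ₑ ^ 2 = ENNReal.ofReal (c ^ 2) * ‖z‖ₑ ^ 2 := by
  rw [enorm_mul, mul_pow, ← ofReal_norm, Complex.norm_real, Real.norm_eq_abs,
    ← ENNReal.ofReal_pow (abs_nonneg c), sq_abs]

/-- **Weighted Plancherel, order one**: `∫ (2π‖ξ‖)² ‖a(ξ)‖² dξ = ∑ᵢ ∫ ‖∂ᵢ f‖²` with `a = 𝓕⁻¹ f`
(`‖ξ‖² = ∑ᵢ ⟪ξ, bᵢ⟫²` over the standard orthonormal basis and the tree's symbol rule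
`∫ ‖2π⟪ξ, v⟫ a‖² = ∫ ‖Df v‖²`). [cite: SteinWeiss1971, Ch. I Thm. 1.8] -/
theorem lintegral_weight_two_fourierInv (hf : ContDiff ℝ ∞ f)
    (hn : ∀ n : ℕ, ∫⁻ x, ‖iteratedFDeriv ℝ n f x‖ₑ ^ 2 < ⊤) :
    ∫⁻ ξ, ENNReal.ofReal ((2 * Real.pi * ‖ξ‖) ^ 2) *
        ‖((𝓕⁻ ((memLp_two_of_smooth hf (hn 0)).toLp f) : Lp ℂ 2 (volume : Measure E)) : E → ℂ) ξ‖ₑ ^ 2 =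
      ∑ i, ∫⁻ x, ‖fderiv ℝ f x (stdOrthonormalBasis ℝ E i)‖ₑ ^ 2 := by
  set b := stdOrthonormalBasis ℝ E with hb
  set A : E → ℂ := ((𝓕⁻ ((memLp_two_of_smooth hf (hn 0)).toLp f) : Lp ℂ 2 (volume : Measure E)) :
    E → ℂ) with hA
  have hAm : AEStronglyMeasurable A volume := (Lp.memLp _).aestronglyMeasurable
  -- pointwise expansion of the weight
  have hpt : ∀ ξ : E, ENNReal.ofReal ((2 * Real.pi * ‖ξ‖) ^ 2) * ‖A ξ‖ₑ ^ 2 =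
      ∑ i, ‖((2 * Real.pi * ⟪ξ, b i⟫ : ℝ) : ℂ) * A ξ‖ₑ ^ 2 := by
    intro ξ
    simp_rw [enorm_ofReal_mul_sq]
    rw [← Finset.sum_mul, ← ENNReal.ofReal_sum_of_nonneg (fun i _ => sq_nonneg _)]
    congr 2
    rw [mul_pow, ← b.sum_sq_inner_left ξ, Finset.mul_sum]
    exact Finset.sum_congr rfl fun i _ => by ring
  simp_rw [hpt]
  rw [lintegral_finsetSum' _ fun i _ => ?_]
  · exact Finset.sum_congr rfl fun i _ => lintegral_enorm_sq_inner_mul_fourierInv hf hn (b i)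
  · exact ((Complex.continuous_ofReal.comp (by fun_prop)).aestronglyMeasurable.mul hAm).enorm.pow_const 2

/-- **Weighted Plancherel, order two**: `∫ (2π‖ξ‖)⁴ ‖a(ξ)‖² dξ = ∑ᵢ ∑ⱼ ∫ ‖∂ᵢ∂ⱼ f‖²` with `a = 𝓕⁻¹ f`
(the symbol rule applied to `f` in the direction `bⱼ`, `⟪ξ, bⱼ⟫ a = (−2πi)⁻¹ 𝓕⁻¹(∂ⱼf)` a.e., and then to
`∂ⱼ f` in the direction `bᵢ`). [cite: SteinWeiss1971, Ch. I Thm. 1.8] -/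
theorem lintegral_weight_four_fourierInv (hf : ContDiff ℝ ∞ f)
    (hn : ∀ n : ℕ, ∫⁻ x, ‖iteratedFDeriv ℝ n f x‖ₑ ^ 2 < ⊤) :
    ∫⁻ ξ, ENNReal.ofReal ((2 * Real.pi * ‖ξ‖) ^ 4) *
        ‖((𝓕⁻ ((memLp_two_of_smooth hf (hn 0)).toLp f) : Lp ℂ 2 (volume : Measure E)) : E → ℂ) ξ‖ₑ ^ 2 =
      ∑ i, ∑ j, ∫⁻ x, ‖fderiv ℝ (fun y => fderiv ℝ f y (stdOrthonormalBasis ℝ E j)) x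
        (stdOrthonormalBasis ℝ E i)‖ₑ ^ 2 := by
  set b := stdOrthonormalBasis ℝ E with hb
  set A : E → ℂ := ((𝓕⁻ ((memLp_two_of_smooth hf (hn 0)).toLp f) : Lp ℂ 2 (volume : Measure E)) :
    E → ℂ) with hA
  have hAm : AEStronglyMeasurable A volume := (Lp.memLp _).aestronglyMeasurable
  -- pointwise expansion of the weight
  have hpt : ∀ ξ : E, ENNReal.ofReal ((2 * Real.pi * ‖ξ‖) ^ 4) * ‖A ξ‖ₑ ^ 2 =
      ∑ i, ∑ j, ‖((2 * Real.pi * ⟪ξ, b i⟫ : ℝ) : ℂ) *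
        (((2 * Real.pi * ⟪ξ, b j⟫ : ℝ) : ℂ) * A ξ)‖ₑ ^ 2 := by
    intro ξ
    have hsq : ∑ i, (2 * Real.pi * ⟪ξ, b i⟫) ^ 2 = (2 * Real.pi * ‖ξ‖) ^ 2 := by
      rw [mul_pow, ← b.sum_sq_inner_left ξ, Finset.mul_sum]
      exact Finset.sum_congr rfl fun i _ => by ring
    have hS : ∑ i, ENNReal.ofReal ((2 * Real.pi * ⟪ξ, b i⟫) ^ 2) =
        ENNReal.ofReal ((2 * Real.pi * ‖ξ‖) ^ 2) := by
      rw [← ENNReal.ofReal_sum_of_nonneg (fun i _ => sq_nonneg _), hsq]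
    symm
    calc ∑ i, ∑ j, ‖((2 * Real.pi * ⟪ξ, b i⟫ : ℝ) : ℂ) * (((2 * Real.pi * ⟪ξ, b j⟫ : ℝ) : ℂ) * A ξ)‖ₑ ^ 2
        = ∑ i, ∑ j, ENNReal.ofReal ((2 * Real.pi * ⟪ξ, b i⟫) ^ 2) *
            (ENNReal.ofReal ((2 * Real.pi * ⟪ξ, b j⟫) ^ 2) * ‖A ξ‖ₑ ^ 2) := by
          simp_rw [enorm_ofReal_mul_sq]
      _ = (∑ i, ENNReal.ofReal ((2 * Real.pi * ⟪ξ, b i⟫) ^ 2)) *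
            ((∑ j, ENNReal.ofReal ((2 * Real.pi * ⟪ξ, b j⟫) ^ 2)) * ‖A ξ‖ₑ ^ 2) := by
          rw [Finset.sum_mul]
          exact Finset.sum_congr rfl fun i _ => by rw [Finset.sum_mul, Finset.mul_sum]
      _ = ENNReal.ofReal ((2 * Real.pi * ‖ξ‖) ^ 4) * ‖A ξ‖ₑ ^ 2 := by
          rw [hS, ← mul_assoc, ← ENNReal.ofReal_mul (sq_nonneg _)]
          congr 2
          ring
  -- the order-one symbol rule for `f` in the direction `b j`, a.e.
  have hg : ∀ j, ContDiff ℝ ∞ (fun y => fderiv ℝ f y (b j)) ∧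
      ∀ n : ℕ, ∫⁻ x, ‖iteratedFDeriv ℝ n (fun y => fderiv ℝ f y (b j)) x‖ₑ ^ 2 < ⊤ :=
    fun j => smooth_l2_fderiv_apply hf hn (b j)
  have hterm : ∀ i j, ∫⁻ ξ, ‖((2 * Real.pi * ⟪ξ, b i⟫ : ℝ) : ℂ) *
      (((2 * Real.pi * ⟪ξ, b j⟫ : ℝ) : ℂ) * A ξ)‖ₑ ^ 2 =
        ∫⁻ x, ‖fderiv ℝ (fun y => fderiv ℝ f y (b j)) x (b i)‖ₑ ^ 2 := by
    intro i j
    set Aj : E → ℂ := ((𝓕⁻ ((memLp_two_of_smooth (hg j).1 ((hg j).2 0)).toLp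
      (fun y => fderiv ℝ f y (b j))) : Lp ℂ 2 (volume : Measure E)) : E → ℂ) with hAj
    have hae : (fun ξ => (((⟪ξ, b j⟫) : ℝ) : ℂ) * A ξ) =ᵐ[volume]
        fun ξ => (-(2 * Real.pi * Complex.I))⁻¹ * Aj ξ := by
      have h := (memLp_inner_pow_mul_fourierInv hf hn (b j) 1).2
      simp only [pow_one, Function.iterate_one] at h
      exact h
    have hunit : ‖((2 * Real.pi : ℝ) : ℂ) * (-(2 * Real.pi * Complex.I))⁻¹‖ₑ = 1 := by
      rw [← ofReal_norm, norm_mul, norm_inv, norm_neg, norm_mul, Complex.norm_real, Complex.norm_I,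
        mul_one, Real.norm_of_nonneg (by positivity)]
      have hπ : ‖(2 * Real.pi : ℂ)‖ = 2 * Real.pi := by
        rw [show (2 * Real.pi : ℂ) = ((2 * Real.pi : ℝ) : ℂ) by push_cast; ring, Complex.norm_real,
          Real.norm_of_nonneg (by positivity)]
      rw [hπ, mul_inv_cancel₀ (by positivity), ENNReal.ofReal_one]
    rw [← lintegral_enorm_sq_inner_mul_fourierInv (hg j).1 (hg j).2 (b i)]
    refine lintegral_congr_ae ?_
    filter_upwards [hae] with ξ hξ
    have e1 : ((2 * Real.pi * ⟪ξ, b j⟫ : ℝ) : ℂ) * A ξ =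
        ((2 * Real.pi : ℝ) : ℂ) * ((((⟪ξ, b j⟫) : ℝ) : ℂ) * A ξ) := by push_cast; ring
    rw [e1, hξ, show ((2 * Real.pi : ℝ) : ℂ) * ((-(2 * Real.pi * Complex.I))⁻¹ * Aj ξ) =
      (((2 * Real.pi : ℝ) : ℂ) * (-(2 * Real.pi * Complex.I))⁻¹) * Aj ξ by ring,
      mul_left_comm, enorm_mul, hunit, one_mul]
  simp_rw [hpt]
  rw [lintegral_finsetSum' _ fun i _ => ?_]
  · refine Finset.sum_congr rfl fun i _ => ?_
    rw [lintegral_finsetSum' _ fun j _ => ?_]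
    · exact Finset.sum_congr rfl fun j _ => hterm i j
    · exact ((Complex.continuous_ofReal.comp (by fun_prop)).aestronglyMeasurable.mul
        ((Complex.continuous_ofReal.comp (by fun_prop)).aestronglyMeasurable.mul hAm)).enorm.pow_const 2
  · refine Finset.aemeasurable_fun_sum _ fun j _ => ?_
    exact ((Complex.continuous_ofReal.comp (by fun_prop)).aestronglyMeasurable.mul
        ((Complex.continuous_ofReal.comp (by fun_prop)).aestronglyMeasurable.mul hAm)).enorm.pow_const 2

end Fourier

end Summit.NavierStokesRegularity.NavierStokesRegularity.Theorems.AgmonExplicit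

end
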